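/-
Copyright (c) 2026 the pub-hodgecm-mathlib formalisation cell (harness21).  Prover seat hodgecm-mathlib-R90-IF-p01 (g0), programme R90-TF, section S9 «InnerForm-13.3.6 (c)»,
deal «G′-DATUM FIELDS» — the finite part of Hilbert reciprocity for the form signs `ε_v(H)` of a CM-hermitian `H` (datum-free).
-/
import Literature.NumberTheory.Automorphic.LocalHermitianFormSign                             -- ★ `formSignAt`, `formSignAt_eq_hilbertSymbol`, `exists_cm_delta`
import Literature.NumberTheory.Automorphic.QuaternionRamificationParityHolds                  -- ★ `hilbertReciprocity_holds` (O'Meara 71:18, a THEOREM of the tree)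
import Literature.NumberTheory.QuadraticForms.HilbertSymbolArchimedean                        -- ★ `setOf_hilbertSymbol_completion_eq_neg_one` (real places: both entries negative)
import HarnessLib

/-!
# R90-TF · S9 — `∏_{v<∞} ε_v(H) = (−1)^{#{w : −det H <_w 0}}` for a CM-hermitian `H ∈ M₃(L)`: the finite part of Hilbert reciprocity (O'Meara 71:18; Rogawski 1990 §14.6 p. 243)

Cell `hodgecm-mathlib`, crux H413 = `stmt-HodgeConjecture-24833` (supports-only, count-neutral), route `HCCMUnconditional`; programme R90-TF, section S9, seat R90-IF-p01 (g0).
THEOREMS ONLY (`--kind proof`); no def, no instance, no named-fact hypothesis, no `sorry`.  Datum-free feeder of `R90S9InnerFormSec146FramedSign` (`(−1)^N c = 1` at `Γ₀^{sph}`).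
MATHEMATICS.  `ε_v(H) = (−det H, d)_v` at the finite places of `L⁺` (★ `formSignAt_eq_hilbertSymbol`, `L = L⁺(√d)`, `d = δ²`, `c̄ δ = −δ`); Hilbert reciprocity over `L⁺`
(★ `hilbertReciprocity_holds`): the places, finite and real, with symbol `−1` are even in number; at a real `w`, `(−det H, d)_w = −1 iff −det H <_w 0 ∧ d <_w 0`
(★ `setOf_hilbertSymbol_completion_eq_neg_one`), and `d` is negative at EVERY real place (under the complex place above `w`, `δ` is purely imaginary — Mathlib
`IsCMField.complexEmbedding_complexConj`).  Hence `∏_{v<∞} ε_v(H) = (−1)^{#{v : ε_v = −1}} = (−1)^{#{w : −det H <_w 0}}`.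
CONTENTS (ns `…R90.S9.InnerFormSec146`): `finprod_intCast_eq_neg_one_pow`, `neg_one_pow_eq_of_even_add`, `embedding_equivInfinitePlace`, `isReal_equivInfinitePlace`,
`embedding_of_isReal_lt_zero_of_cm_delta`, **`finprod_formSignAt_eq_neg_one_pow_ncard (hH) (hdet)`**.
HONEST LABEL: sign bookkeeping; HC_CM is proved only modulo the 7 printed citations (2 remaining named inputs: hLiu418 = `stmt-HodgeConjecture-24832`, h413 =
`stmt-HodgeConjecture-24833`) until rung 0 closes.  References: [Omeara1963] §63B, §71 Thm. 71:18; [Rogawski1990] §14.6 p. 243.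
-/

set_option autoImplicit false
set_option linter.dupNamespace false  -- the mandated namespace repeats the summit's segment (`HodgeConjecture.HodgeConjecture`)

noncomputable section

open NumberField IsDedekindDomain
open scoped Matrix ComplexConjugate
open Literature.NumberTheory Literature.NumberTheory.Automorphic Literature.NumberTheory.Automorphic.UnitaryGroup
open Literature.NumberTheory.QuadraticForms

namespace Summit.HodgeConjecture.HodgeConjecture.R90.S9.InnerFormSec146

/-! ## §15 `∏_{v<∞} ε_v(H) = (−1)^{#{w : −det H <_w 0}}` (datum-free; Hilbert reciprocity) -/

section SignProduct

/-- A product of signs: for `f : α → ℤ` with values in `{±1}` and finitely many `−1`'s, `∏ᶠ_a (f a : ℂ) = (−1)^{#{a | f a = −1}}`. [cite: Omeara1963, §71 Thm. 71:18] -/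
theorem finprod_intCast_eq_neg_one_pow {α : Type*} (f : α → ℤ) (hf : ∀ a, f a = 1 ∨ f a = -1) (hfin : {a | f a = -1}.Finite) :
    (∏ᶠ a, (f a : ℂ)) = (-1) ^ {a | f a = -1}.ncard := by
  have hsupp : (Function.mulSupport fun a => (f a : ℂ)) ⊆ ↑hfin.toFinset := by
    intro a ha
    rw [Function.mem_mulSupport] at ha
    rw [Set.Finite.coe_toFinset, Set.mem_setOf_eq]
    rcases hf a with h | h
    · exact absurd (by rw [h, Int.cast_one]) ha
    · exact h
  rw [finprod_eq_prod_of_mulSupport_subset _ hsupp, Set.ncard_eq_toFinset_card _ hfin, ← Finset.prod_const]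
  refine Finset.prod_congr rfl fun a ha => ?_
  rw [Set.Finite.mem_toFinset, Set.mem_setOf_eq] at ha
  rw [ha]
  norm_num

/-- Parity transfer: `m + n` even ⇒ `(−1)^m = (−1)^n`. [cite: Omeara1963, §71 Thm. 71:18] -/
theorem neg_one_pow_eq_of_even_add {m n : ℕ} (h : Even (m + n)) : (-1 : ℂ) ^ m = (-1) ^ n := by
  rw [Nat.even_add] at h
  rcases Nat.even_or_odd n with hn | hn
  · rw [hn.neg_one_pow, (h.2 hn).neg_one_pow]
  · rw [hn.neg_one_pow, (Nat.not_even_iff_odd.1 fun hm => (Nat.not_even_iff_odd.2 hn) (h.1 hm)).neg_one_pow]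

variable (L : Type) [Field L] [NumberField L] [IsCMField L]

/-- The place of `L⁺` below `w′` has real embedding `w′.embedding ∘ (L⁺ ↪ L)` (a real embedding: `L⁺` is fixed by complex conjugation). [cite: Omeara1963, §63B] -/
theorem embedding_equivInfinitePlace (w' : InfinitePlace L) :
    (IsCMField.equivInfinitePlace L w').embedding = w'.embedding.comp (algebraMap (↥(maximalRealSubfield L)) L) := by
  have hreal : ComplexEmbedding.IsReal (w'.embedding.comp (algebraMap (↥(maximalRealSubfield L)) L)) := by
    rw [ComplexEmbedding.isReal_iff]
    ext k
    rw [ComplexEmbedding.conjugate_coe_eq, RingHom.comp_apply, ← IsCMField.complexEmbedding_complexConj]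
    exact congrArg w'.embedding (IsCMField.complexConj_apply_eq_self (K := L) k)
  rw [IsCMField.equivInfinitePlace_apply, ← InfinitePlace.mk_embedding w', InfinitePlace.comap_mk, InfinitePlace.mk_embedding,
    InfinitePlace.embedding_mk_eq_of_isReal hreal]

/-- Every place of `L⁺` is real, read through `equivInfinitePlace`: the embedding of the place below `w′` is the real embedding `w′.embedding ∘ (L⁺ ↪ L)`.
[cite: Omeara1963, §63B] -/
theorem isReal_equivInfinitePlace (w' : InfinitePlace L) : (IsCMField.equivInfinitePlace L w').IsReal := by
  rw [InfinitePlace.isReal_iff, embedding_equivInfinitePlace, ComplexEmbedding.isReal_iff]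
  ext k
  rw [ComplexEmbedding.conjugate_coe_eq, RingHom.comp_apply, ← IsCMField.complexEmbedding_complexConj]
  exact congrArg w'.embedding (IsCMField.complexConj_apply_eq_self (K := L) k)

/-- **A CM square is totally negative**: for `δ ∈ L` with `c̄ δ = −δ ≠ 0` and `δ² = d ∈ L⁺`, `d < 0` at every (real) place `w` of `L⁺` — under the complex place of `L` above `w`,
`δ` is purely imaginary (Mathlib `IsCMField.complexEmbedding_complexConj`), so `δ² = −(Im δ)² < 0`. [cite: Omeara1963, §63B] -/
theorem embedding_of_isReal_lt_zero_of_cm_delta {δ : L} {d : ↥(maximalRealSubfield L)} (hσδ : IsCMField.complexConj L δ = -δ) (hδ : δ ≠ 0)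
    (hd : δ * δ = algebraMap (↥(maximalRealSubfield L)) L d) (w : InfinitePlace ↥(maximalRealSubfield L)) (hw : w.IsReal) :
    InfinitePlace.embedding_of_isReal hw d < 0 := by
  set w' : InfinitePlace L := (IsCMField.equivInfinitePlace L).symm w with hw'
  set φ : L →+* ℂ := w'.embedding with hφ
  have hreal : ComplexEmbedding.IsReal (φ.comp (algebraMap (↥(maximalRealSubfield L)) L)) := by
    rw [ComplexEmbedding.isReal_iff]
    ext k
    rw [ComplexEmbedding.conjugate_coe_eq, RingHom.comp_apply, ← IsCMField.complexEmbedding_complexConj]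
    exact congrArg φ (IsCMField.complexConj_apply_eq_self (K := L) k)
  have hmk : InfinitePlace.mk (φ.comp (algebraMap (↥(maximalRealSubfield L)) L)) = w := by
    rw [← InfinitePlace.comap_mk, hφ, InfinitePlace.mk_embedding, ← IsCMField.equivInfinitePlace_apply, hw', Equiv.apply_symm_apply]
  have hembw : w.embedding = φ.comp (algebraMap (↥(maximalRealSubfield L)) L) := by
    rw [← hmk, InfinitePlace.embedding_mk_eq_of_isReal hreal]
  have hemb : ((InfinitePlace.embedding_of_isReal hw d : ℝ) : ℂ) = φ (algebraMap (↥(maximalRealSubfield L)) L d) := by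
    rw [InfinitePlace.embedding_of_isReal_apply, hembw, RingHom.comp_apply]
  -- `φ δ` is purely imaginary and non-zero
  have hconj : conj (φ δ) = -φ δ := by
    rw [← IsCMField.complexEmbedding_complexConj, hσδ, map_neg]
  have hre : (φ δ).re = 0 := by
    have h := congrArg Complex.re hconj
    rw [Complex.conj_re, Complex.neg_re] at h
    linarith
  have hne : φ δ ≠ 0 := (map_ne_zero φ).2 hδ
  have him : (φ δ).im ≠ 0 := by
    intro h0
    exact hne (Complex.ext (by rw [hre, Complex.zero_re]) (by rw [h0, Complex.zero_im]))
  have hval : φ (algebraMap (↥(maximalRealSubfield L)) L d) = -((((φ δ).im * (φ δ).im : ℝ)) : ℂ) := by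
    rw [← hd, map_mul]
    apply Complex.ext
    · simp [Complex.mul_re, hre]
    · simp [Complex.mul_im, hre]
  have hlt : InfinitePlace.embedding_of_isReal hw d = -((φ δ).im * (φ δ).im) := by
    exact_mod_cast hemb.trans hval
  rw [hlt, neg_lt_zero]
  exact mul_self_pos.2 him

/-- **`∏_{v<∞} ε_v(H) = (−1)^{#{w : −det H <_w 0}}`** for a non-degenerate CM-hermitian `H ∈ M₃(L)`: the finite part of Hilbert reciprocity for `(−det H, d)` over `L⁺`
(★ `hilbertReciprocity_holds`), read through ★ `formSignAt_eq_hilbertSymbol` at the finite places and ★ `setOf_hilbertSymbol_completion_eq_neg_one` + «`d` totally negative» at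
the real ones. [cite: Omeara1963, §71 Thm. 71:18; §63B] [cite: Rogawski1990, §14.6 p. 243] -/
theorem finprod_formSignAt_eq_neg_one_pow_ncard (H : Matrix (Fin 3) (Fin 3) L) (hH : (H.map (cmConjRingHom L))ᵀ = H) (hdet : H.det ≠ 0) :
    (∏ᶠ v : HeightOneSpectrum (𝓞 ↥(maximalRealSubfield L)), (formSignAt L (IsCMField.complexConj L) H v : ℂ)) =
      (-1) ^ {w : InfinitePlace ↥(maximalRealSubfield L) | ∃ hw : w.IsReal,
        InfinitePlace.embedding_of_isReal hw (⟨-H.det, neg_det_mem_maximalRealSubfield_of_isHermitian L hH⟩ : ↥(maximalRealSubfield L)) < 0}.ncard := by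
  haveI : Algebra.IsQuadraticExtension ↥(maximalRealSubfield L) L := IsCMField.isQuadraticExtension L
  obtain ⟨δ, d, hσδ, hδ, hd, hd0⟩ := exists_cm_delta L
  set x : ↥(maximalRealSubfield L) := ⟨-H.det, neg_det_mem_maximalRealSubfield_of_isHermitian L hH⟩ with hxdef
  have hx : algebraMap (↥(maximalRealSubfield L)) L x = -H.det := rfl
  have hx0 : x ≠ 0 := by
    intro h0
    have h1 : (-H.det : L) = 0 := by
      have := congrArg (fun z : ↥(maximalRealSubfield L) => (z : L)) h0
      simpa [hxdef] using this
    exact hdet (neg_eq_zero.1 h1)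
  have hd0' : (d : ↥(maximalRealSubfield L)) ≠ 0 := hd0
  -- the finite places: `ε_v(H) = (x, d)_v`
  have key : ∀ v : HeightOneSpectrum (𝓞 ↥(maximalRealSubfield L)), formSignAt L (IsCMField.complexConj L) H v =
      hilbertSymbol (v.adicCompletion ↥(maximalRealSubfield L)) (algebraMap _ _ x) (algebraMap _ _ d) :=
    fun v => formSignAt_eq_hilbertSymbol L (IsCMField.complexConj L) H v hσδ hδ hd (IsCMField.complexConj_ne_one L) hx0 hx
  obtain ⟨hfin, heven⟩ := hilbertReciprocity_holds (↥(maximalRealSubfield L)) x d hx0 hd0'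
  have hset : {v : HeightOneSpectrum (𝓞 ↥(maximalRealSubfield L)) | formSignAt L (IsCMField.complexConj L) H v = -1} =
      {v | hilbertSymbol (v.adicCompletion ↥(maximalRealSubfield L)) (algebraMap _ _ x) (algebraMap _ _ (d : ↥(maximalRealSubfield L))) = -1} := by
    ext v
    rw [Set.mem_setOf_eq, Set.mem_setOf_eq, key]
  rw [finprod_intCast_eq_neg_one_pow _ (formSignAt_eq_one_or_eq_neg_one L (IsCMField.complexConj L) H) (hset ▸ hfin), hset]
  -- the real places: `(x, d)_w = −1 ↔ x <_w 0` since `d <_w 0` always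
  rw [setOf_hilbertSymbol_completion_eq_neg_one hx0 hd0'] at heven
  have hinf : {w : InfinitePlace ↥(maximalRealSubfield L) | ∃ hw : w.IsReal,
        InfinitePlace.embedding_of_isReal hw x < 0 ∧ InfinitePlace.embedding_of_isReal hw (d : ↥(maximalRealSubfield L)) < 0} =
      {w | ∃ hw : w.IsReal, InfinitePlace.embedding_of_isReal hw x < 0} := by
    ext w
    simp only [Set.mem_setOf_eq]
    exact ⟨fun ⟨hw, h1, _⟩ => ⟨hw, h1⟩, fun ⟨hw, h1⟩ => ⟨hw, h1, embedding_of_isReal_lt_zero_of_cm_delta L hσδ hδ hd w hw⟩⟩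
  rw [hinf] at heven
  exact neg_one_pow_eq_of_even_add heven

end SignProduct

end Summit.HodgeConjecture.HodgeConjecture.R90.S9.InnerFormSec146

end
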